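import Mathlib.Analysis.SpecialFunctions.Trigonometric.Deriv
import Mathlib.Analysis.SpecialFunctions.Pow.Real
import Mathlib.Analysis.Calculus.Deriv.MeanValue
import Mathlib.Analysis.Calculus.ContDiff.Deriv
import HarnessLib

/-!
# Focusing of an admissible oscillatory tail under the free wave equation

For the free wave equation `□φ = 0` on `ℝ^{1+3}` with radial Cauchy data `φ(0, ·) = φ₀(|x|)`,
`∂ₜφ(0, ·) = 0`, Kirchhoff's formula (spherical means) gives the value at the centre
`φ(t, 0) = ∂ₜ (t φ₀(t)) = (r φ₀)'(t)` (Evans, *Partial Differential Equations*, 2nd ed., §2.4.1 (c),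
formula (22) with `g = φ₀`, `h = 0`; equivalently `ψ := rφ` solves the 1D wave equation with odd
reflection).  Take the oscillatory tail `φ₀(r) = sin(r⁵) / r¹²` (away from `r = 0`).  It lies in the
Dafermos–Rodnianski class `o₂(r⁻¹)` of strongly asymptotically flat perturbations
(`r φ₀ → 0`, `r² φ₀' → 0`, `r³ φ₀'' → 0`; arXiv:0811.0354, App. B.2.3; in this tree
`AFEnd.IsStronglyAsymptoticallyFlatDR`, which controls two derivatives of `h` only), while its third
derivative grows like `r`.  The focal value is `f(t) := (rφ₀)'(t) = 5 cos(t⁵)/t⁷ − 11 sin(t⁵)/t¹²`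
(`hasDerivAt_mul_focusingTail`), and this file proves that its second time derivative — the size of
`∂²φ`, i.e. of the (linearised) curvature, at the focus — is UNBOUNDED as `t → ∞`
(`not_bddAbove_deriv_deriv_focalValue`: for every `C` there is `t ≥ 1` with `|f''(t)| > C`; the
growth is `≍ t`).  The proof avoids computing `f''`: at the three consecutive points `t` with
`t⁵ ∈ {(2m+1)π, (2m+2)π, (2m+3)π}` the value `f` alternates in sign with size `5/t⁷`, the points are
`≤ 2π/(5t⁴)` apart, and two applications of the mean value theorem turn a bound `|f''| ≤ C` into
`C ≳ t`.

Why it is here (statement hygiene for the `FinalStateConjecture` routes, not a result about them):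
incoming radiation stored in an ADMISSIBLE tail (weighted `C² × C¹`-small, even `→ 0` as its support
recedes) refocuses at arbitrarily late times with unbounded second derivatives at the focal world-line
although its energy tends to `0`; so pointwise-sup `Cᵏ` closeness to a stationary background on slabs
that keep meeting the focal world-line fails for `k ≥ 2` on such data, at the linear level.  See the
crux memo `Cruxes/SubconvergentEraGeneric/K_HONESTY_AUDIT.md` §5 and the far-wild-tail record of crux
GapExhaustion (stmt-FinalStateConjecture-10808).

## References
* L. C. Evans, *Partial Differential Equations*, 2nd ed., AMS 2010, §2.4.1 (c) (Kirchhoff's formula).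
* M. Dafermos, I. Rodnianski, *Lectures on black holes and linear waves*, arXiv:0811.0354, App. B.2.3.
-/

noncomputable section

open Real Set

namespace Literature.Analysis.PDE

/-- **The focal value is the derivative of `r φ₀`.**  For `φ₀(r) = sin(r⁵)/r¹²` one has
`r φ₀(r) = sin(r⁵)/r¹¹` (for `r ≠ 0`) and `(rφ₀)'(t) = 5 cos(t⁵)/t⁷ − 11 sin(t⁵)/t¹²`; by Kirchhoff's
formula this is the value at the centre, at time `t`, of the solution of the free wave equation on
`ℝ^{1+3}` with data `(φ₀, 0)`.  Evans 2010, §2.4.1 (c). [cite: Evans2010, §2.4.1 (c)] -/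
theorem hasDerivAt_mul_focusingTail {t : ℝ} (ht : t ≠ 0) :
    HasDerivAt (fun r : ℝ => Real.sin (r ^ 5) / r ^ 11)
      (5 * Real.cos (t ^ 5) / t ^ 7 - 11 * Real.sin (t ^ 5) / t ^ 12) t := by
  have h1 : HasDerivAt (fun r : ℝ => Real.sin (r ^ 5)) (Real.cos (t ^ 5) * (5 * t ^ 4)) t := by
    simpa using (hasDerivAt_pow 5 t).sin
  have h3 : HasDerivAt (fun r : ℝ => Real.sin (r ^ 5) / r ^ 11)
      ((Real.cos (t ^ 5) * (5 * t ^ 4) * t ^ 11 - Real.sin (t ^ 5) * (((11 : ℕ) : ℝ) * t ^ (11 - 1))) /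
        (t ^ 11) ^ 2) t :=
    h1.div (hasDerivAt_pow 11 t) (pow_ne_zero 11 ht)
  refine h3.congr_deriv ?_
  rw [show (11 - 1 : ℕ) = 10 from rfl, div_sub_div _ _ (pow_ne_zero 7 ht) (pow_ne_zero 12 ht),
    div_eq_div_iff (by positivity) (by positivity)]
  push_cast
  ring

/-- Elementary spacing estimate: for `0 ≤ a ≤ b`, `(b − a) · 5a⁴ ≤ b⁵ − a⁵` (each of the five
terms of `(b⁵ − a⁵)/(b − a)` is at least `a⁴`). [folklore] -/
theorem sub_mul_five_pow_four_le {a b : ℝ} (ha : 0 ≤ a) (hab : a ≤ b) :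
    (b - a) * (5 * a ^ 4) ≤ b ^ 5 - a ^ 5 := by
  have hid : b ^ 5 - a ^ 5 = (b - a) * (b ^ 4 + b ^ 3 * a + b ^ 2 * a ^ 2 + b * a ^ 3 + a ^ 4) := by
    ring
  have t1 : a ^ 4 ≤ b ^ 4 := pow_le_pow_left₀ ha hab 4
  have t2 : a ^ 3 * a ≤ b ^ 3 * a := mul_le_mul_of_nonneg_right (pow_le_pow_left₀ ha hab 3) ha
  have t3 : a ^ 2 * a ^ 2 ≤ b ^ 2 * a ^ 2 :=
    mul_le_mul_of_nonneg_right (pow_le_pow_left₀ ha hab 2) (pow_nonneg ha 2)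
  have t4 : a * a ^ 3 ≤ b * a ^ 3 := mul_le_mul_of_nonneg_right hab (pow_nonneg ha 3)
  have hsum : 5 * a ^ 4 ≤ b ^ 4 + b ^ 3 * a + b ^ 2 * a ^ 2 + b * a ^ 3 + a ^ 4 := by
    nlinarith [t1, t2, t3, t4]
  rw [hid]
  exact mul_le_mul_of_nonneg_left hsum (sub_nonneg.2 hab)

/-- **Slope-drop lemma** (mean value theorem twice).  If `f` and `deriv f` are differentiable on
`[x₀, x₂]`, `x₀ < x₁ < x₂`, `f x₀ ≤ 0`, `0 ≤ f x₁`, `f x₂ ≤ 0`, and `|f''| ≤ C` on `(x₀, x₂)`, then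
`2 f(x₁) ≤ C (x₂ − x₀)²`: the secant slopes on `[x₀, x₁]` and `[x₁, x₂]` are `≥ f(x₁)/(x₂ − x₀)` resp.
`≤ −f(x₁)/(x₂ − x₀)`, both are values of `f'`, and `f'` is `C`-Lipschitz on `(x₀, x₂)`. [folklore] -/
theorem two_mul_le_of_abs_deriv_deriv_le {f : ℝ → ℝ} {x₀ x₁ x₂ C : ℝ} (h01 : x₀ < x₁)
    (h12 : x₁ < x₂) (hf : DifferentiableOn ℝ f (Icc x₀ x₂))
    (hf' : DifferentiableOn ℝ (deriv f) (Icc x₀ x₂)) (hfx₀ : f x₀ ≤ 0) (hfx₁ : 0 ≤ f x₁)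
    (hfx₂ : f x₂ ≤ 0) (hC : ∀ t ∈ Ioo x₀ x₂, |deriv (deriv f) t| ≤ C) :
    2 * f x₁ ≤ C * (x₂ - x₀) ^ 2 := by
  have h02 : x₀ < x₂ := h01.trans h12
  have hd₀ : 0 < x₁ - x₀ := sub_pos.2 h01
  have hd₁ : 0 < x₂ - x₁ := sub_pos.2 h12
  have hd : 0 < x₂ - x₀ := sub_pos.2 h02
  have hI₀ : Icc x₀ x₁ ⊆ Icc x₀ x₂ := Icc_subset_Icc le_rfl h12.le
  have hI₁ : Icc x₁ x₂ ⊆ Icc x₀ x₂ := Icc_subset_Icc h01.le le_rfl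
  obtain ⟨ξ₀, hξ₀, hξ₀'⟩ := exists_deriv_eq_slope f h01 (hf.continuousOn.mono hI₀)
    (hf.mono (Ioo_subset_Icc_self.trans hI₀))
  obtain ⟨ξ₁, hξ₁, hξ₁'⟩ := exists_deriv_eq_slope f h12 (hf.continuousOn.mono hI₁)
    (hf.mono (Ioo_subset_Icc_self.trans hI₁))
  have hξ : ξ₀ < ξ₁ := hξ₀.2.trans hξ₁.1
  have hIξ : Icc ξ₀ ξ₁ ⊆ Icc x₀ x₂ := Icc_subset_Icc hξ₀.1.le hξ₁.2.le
  obtain ⟨η, hη, hη'⟩ := exists_deriv_eq_slope (deriv f) hξ (hf'.continuousOn.mono hIξ)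
    (hf'.mono (Ioo_subset_Icc_self.trans hIξ))
  have hηmem : η ∈ Ioo x₀ x₂ := ⟨hξ₀.1.trans hη.1, hη.2.trans hξ₁.2⟩
  have hbd := hC η hηmem
  have hC0 : 0 ≤ C := (abs_nonneg _).trans hbd
  -- lower bound on the slope drop
  have hs₀ : f x₁ / (x₂ - x₀) ≤ deriv f ξ₀ := by
    rw [hξ₀']
    have h1 : f x₁ / (x₂ - x₀) ≤ f x₁ / (x₁ - x₀) :=
      div_le_div_of_nonneg_left hfx₁ hd₀ (by linarith)
    have h2 : f x₁ / (x₁ - x₀) ≤ (f x₁ - f x₀) / (x₁ - x₀) :=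
      div_le_div_of_nonneg_right (by linarith) hd₀.le
    exact h1.trans h2
  have hs₁ : deriv f ξ₁ ≤ -(f x₁ / (x₂ - x₀)) := by
    rw [hξ₁']
    have h1 : (f x₂ - f x₁) / (x₂ - x₁) ≤ (-f x₁) / (x₂ - x₁) :=
      div_le_div_of_nonneg_right (by linarith) hd₁.le
    have h2 : f x₁ / (x₂ - x₀) ≤ f x₁ / (x₂ - x₁) :=
      div_le_div_of_nonneg_left hfx₁ hd₁ (by linarith)
    rw [neg_div] at h1
    linarith
  -- upper bound on the slope drop from `|f''| ≤ C`
  have hηd : 0 < ξ₁ - ξ₀ := sub_pos.2 hξ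
  have hup : deriv f ξ₀ - deriv f ξ₁ ≤ C * (x₂ - x₀) := by
    have h1 : deriv f ξ₁ - deriv f ξ₀ = deriv (deriv f) η * (ξ₁ - ξ₀) := by
      rw [hη', div_mul_cancel₀ _ hηd.ne']
    have h2 : |deriv f ξ₀ - deriv f ξ₁| ≤ C * (ξ₁ - ξ₀) := by
      rw [abs_sub_comm, h1, abs_mul, abs_of_pos hηd]
      exact mul_le_mul_of_nonneg_right hbd hηd.le
    have h3 : C * (ξ₁ - ξ₀) ≤ C * (x₂ - x₀) :=
      mul_le_mul_of_nonneg_left (by linarith [hξ₀.1, hξ₁.2]) hC0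
    exact ((le_abs_self _).trans h2).trans h3
  -- combine
  have h : 2 * (f x₁ / (x₂ - x₀)) ≤ C * (x₂ - x₀) := by linarith
  rw [mul_div_assoc', div_le_iff₀ hd] at h
  nlinarith [h]

/-- **Three consecutive half-periods of `sin(t⁵)`.**  For every `m : ℕ` there are
`0 < x₀ < x₁ < x₂` with `x₀⁵ = (2m+1)π`, `x₁⁵ = (2m+2)π`, `x₂⁵ = (2m+3)π`, hence `x₁ ≤ 2x₀` and
`(x₂ − x₀) · 5x₀⁴ ≤ 2π` (the points crowd together like `t⁻⁴`). [folklore] -/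
theorem exists_three_fifth_roots (m : ℕ) :
    ∃ x₀ x₁ x₂ : ℝ, 1 < x₀ ∧ x₀ < x₁ ∧ x₁ < x₂ ∧ x₀ ^ 5 = ((2 * m + 1 : ℕ) : ℝ) * π ∧
      x₁ ^ 5 = ((2 * m + 2 : ℕ) : ℝ) * π ∧ x₂ ^ 5 = ((2 * m + 3 : ℕ) : ℝ) * π ∧
      x₁ ≤ 2 * x₀ ∧ (x₂ - x₀) * (5 * x₀ ^ 4) ≤ 2 * π := by
  have hπ := Real.pi_pos
  obtain ⟨x₀, hx₀nn, h05⟩ : ∃ x : ℝ, 0 ≤ x ∧ x ^ 5 = ((2 * m + 1 : ℕ) : ℝ) * π :=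
    ⟨_, Real.rpow_nonneg (by positivity) _, Real.rpow_inv_natCast_pow (by positivity) (by norm_num)⟩
  obtain ⟨x₁, hx₁nn, h15⟩ : ∃ x : ℝ, 0 ≤ x ∧ x ^ 5 = ((2 * m + 2 : ℕ) : ℝ) * π :=
    ⟨_, Real.rpow_nonneg (by positivity) _, Real.rpow_inv_natCast_pow (by positivity) (by norm_num)⟩
  obtain ⟨x₂, hx₂nn, h25⟩ : ∃ x : ℝ, 0 ≤ x ∧ x ^ 5 = ((2 * m + 3 : ℕ) : ℝ) * π :=
    ⟨_, Real.rpow_nonneg (by positivity) _, Real.rpow_inv_natCast_pow (by positivity) (by norm_num)⟩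
  have h1x₀ : 1 < x₀ := by
    refine lt_of_pow_lt_pow_left₀ 5 hx₀nn ?_
    rw [one_pow, h05]
    have : (1 : ℝ) ≤ ((2 * m + 1 : ℕ) : ℝ) := by exact_mod_cast Nat.succ_le_succ (Nat.zero_le _)
    nlinarith [Real.two_le_pi]
  have h01 : x₀ < x₁ := by
    refine lt_of_pow_lt_pow_left₀ 5 hx₁nn ?_
    rw [h05, h15]; gcongr; omega
  have h12 : x₁ < x₂ := by
    refine lt_of_pow_lt_pow_left₀ 5 hx₂nn ?_
    rw [h15, h25]; gcongr; omega
  refine ⟨x₀, x₁, x₂, h1x₀, h01, h12, h05, h15, h25, ?_, ?_⟩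
  · refine le_of_pow_le_pow_left₀ (by norm_num : (5 : ℕ) ≠ 0) (by linarith) ?_
    rw [mul_pow, h15, h05]; push_cast; nlinarith
  · have h2π : x₂ ^ 5 - x₀ ^ 5 = 2 * π := by rw [h25, h05]; push_cast; ring
    exact (sub_mul_five_pow_four_le hx₀nn (h01.trans h12).le).trans h2π.le

/-- **The second time derivative of the focal value is unbounded** (linear focusing of an
admissible oscillatory tail).  With `f(t) = 5 cos(t⁵)/t⁷ − 11 sin(t⁵)/t¹²` — the value at the centre
of the free wave with radial data `(sin(r⁵)/r¹², 0)`, see `hasDerivAt_mul_focusingTail` — for every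
`C` there is `t ≥ 1` with `|f''(t)| > C` (in fact `|f''(t)| ≳ t` along `t⁵ ∈ πℕ`), although the data
are `o₂(r⁻¹)`-small at infinity.  Proof: `two_mul_le_of_abs_deriv_deriv_le` at the points of
`exists_three_fifth_roots`, where `f = ∓5/t⁷`.  Evans 2010, §2.4.1 (c); Dafermos–Rodnianski
arXiv:0811.0354, App. B.2.3 (the class `o₂`). [cite: Evans2010, §2.4.1 (c)] -/
theorem not_bddAbove_deriv_deriv_focalValue (C : ℝ) :
    ∃ t : ℝ, 1 ≤ t ∧ C < |deriv (deriv
      (fun r : ℝ => 5 * Real.cos (r ^ 5) / r ^ 7 - 11 * Real.sin (r ^ 5) / r ^ 12)) t| := by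
  set f : ℝ → ℝ := fun r => 5 * Real.cos (r ^ 5) / r ^ 7 - 11 * Real.sin (r ^ 5) / r ^ 12 with hf
  by_contra! hC
  -- regularity of `f` on `(0, ∞)`
  have hcd : ContDiffOn ℝ 2 f (Ioi 0) := by
    have hc : ContDiff ℝ 2 (fun r : ℝ => 5 * Real.cos (r ^ 5)) :=
      contDiff_const.mul (Real.contDiff_cos.comp (contDiff_id.pow 5))
    have hs : ContDiff ℝ 2 (fun r : ℝ => 11 * Real.sin (r ^ 5)) :=
      contDiff_const.mul (Real.contDiff_sin.comp (contDiff_id.pow 5))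
    refine (hc.contDiffOn.div (contDiff_id.pow 7).contDiffOn fun x hx => ?_).sub
      (hs.contDiffOn.div (contDiff_id.pow 12).contDiffOn fun x hx => ?_)
    · exact pow_ne_zero 7 (ne_of_gt hx)
    · exact pow_ne_zero 12 (ne_of_gt hx)
  have hdiff : DifferentiableOn ℝ f (Ioi 0) := hcd.differentiableOn (by norm_num)
  have hcd' : ContDiffOn ℝ 1 (deriv f) (Ioi 0) := hcd.deriv_of_isOpen isOpen_Ioi (by norm_num)
  have hdiff' : DifferentiableOn ℝ (deriv f) (Ioi 0) := hcd'.differentiableOn one_ne_zero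
  -- a large odd multiple of `π` and the three points
  have hπ := Real.pi_pos
  obtain ⟨m, hm⟩ := exists_nat_gt ((40 * |C| + 40) ^ 5 / π)
  have hmπ : (40 * |C| + 40) ^ 5 < ((2 * m + 1 : ℕ) : ℝ) * π := by
    rw [div_lt_iff₀ hπ] at hm
    have : (m : ℝ) * π ≤ ((2 * m + 1 : ℕ) : ℝ) * π := by
      gcongr; omega
    linarith
  obtain ⟨x₀, x₁, x₂, h1x₀, h01, h12, h05, h15, h25, hx₁le, hgap⟩ := exists_three_fifth_roots m
  have hx₀pos : 0 < x₀ := by linarith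
  have hx₁pos : 0 < x₁ := hx₀pos.trans h01
  have hCx₀ : 40 * |C| + 40 < x₀ := by
    refine lt_of_pow_lt_pow_left₀ 5 hx₀pos.le ?_
    rw [h05]; exact hmπ
  -- values of `f` at the three points
  have hf₀ : f x₀ = -5 / x₀ ^ 7 := by
    have hc : Real.cos (x₀ ^ 5) = -1 := by
      rw [h05, Real.cos_nat_mul_pi]; exact Odd.neg_one_pow ⟨m, rfl⟩
    have hs : Real.sin (x₀ ^ 5) = 0 := by rw [h05]; exact Real.sin_nat_mul_pi _
    simp only [hf, hc, hs]; ring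
  have hf₁ : f x₁ = 5 / x₁ ^ 7 := by
    have hc : Real.cos (x₁ ^ 5) = 1 := by
      rw [h15, Real.cos_nat_mul_pi]; exact Even.neg_one_pow ⟨m + 1, by ring⟩
    have hs : Real.sin (x₁ ^ 5) = 0 := by rw [h15]; exact Real.sin_nat_mul_pi _
    simp only [hf, hc, hs]; ring
  have hf₂ : f x₂ = -5 / x₂ ^ 7 := by
    have hc : Real.cos (x₂ ^ 5) = -1 := by
      rw [h25, Real.cos_nat_mul_pi]; exact Odd.neg_one_pow ⟨m + 1, by ring⟩
    have hs : Real.sin (x₂ ^ 5) = 0 := by rw [h25]; exact Real.sin_nat_mul_pi _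
    simp only [hf, hc, hs]; ring
  have hx₀7 : 0 < x₀ ^ 7 := pow_pos hx₀pos 7
  have hx₁7 : 0 < x₁ ^ 7 := pow_pos hx₁pos 7
  have hx₂7 : 0 < x₂ ^ 7 := pow_pos (hx₁pos.trans h12) 7
  have hfx₀ : f x₀ ≤ 0 := by rw [hf₀, div_le_iff₀ hx₀7]; norm_num
  have hfx₁ : 0 ≤ f x₁ := by rw [hf₁]; exact (div_pos (by norm_num) hx₁7).le
  have hfx₂ : f x₂ ≤ 0 := by rw [hf₂, div_le_iff₀ hx₂7]; norm_num
  -- the slope-drop lemma on `[x₀, x₂] ⊆ (0, ∞)`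
  have hsub : Icc x₀ x₂ ⊆ Ioi 0 := fun y hy => hx₀pos.trans_le hy.1
  have hkey := two_mul_le_of_abs_deriv_deriv_le h01 h12 (hdiff.mono hsub) (hdiff'.mono hsub)
    hfx₀ hfx₁ hfx₂ fun t ht => hC t (h1x₀.le.trans ht.1.le)
  -- `10 / x₁⁷ ≤ C (x₂ - x₀)²` with `x₁⁷ ≤ 128 x₀⁷` and `(x₂ - x₀) ≤ 2π/(5 x₀⁴)`
  rw [hf₁] at hkey
  have hC0 : 0 ≤ C := by
    have h1 : 0 < 2 * (5 / x₁ ^ 7) := by positivity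
    have h2 : 0 < (x₂ - x₀) ^ 2 := pow_pos (sub_pos.2 (h01.trans h12)) 2
    nlinarith
  have hd : 0 < x₂ - x₀ := sub_pos.2 (h01.trans h12)
  have hx₀4 : 0 < 5 * x₀ ^ 4 := mul_pos (by norm_num) (pow_pos hx₀pos 4)
  have hgap' : x₂ - x₀ ≤ 2 * π / (5 * x₀ ^ 4) := by rwa [le_div_iff₀ hx₀4]
  have hsq : (x₂ - x₀) ^ 2 ≤ (2 * π / (5 * x₀ ^ 4)) ^ 2 := pow_le_pow_left₀ hd.le hgap' 2
  have hx₁7le : x₁ ^ 7 ≤ 128 * x₀ ^ 7 := by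
    calc x₁ ^ 7 ≤ (2 * x₀) ^ 7 := pow_le_pow_left₀ hx₁pos.le hx₁le 7
      _ = 128 * x₀ ^ 7 := by ring
  -- `10 ≤ C (x₂-x₀)² x₁⁷ ≤ C (2π/(5x₀⁴))² · 128 x₀⁷ = 512 C π² / (25 x₀)`
  have h1 : 10 ≤ C * (x₂ - x₀) ^ 2 * x₁ ^ 7 := by
    rw [mul_div_assoc', div_le_iff₀ hx₁7] at hkey
    linarith
  have h2 : C * (x₂ - x₀) ^ 2 * x₁ ^ 7 ≤ C * (2 * π / (5 * x₀ ^ 4)) ^ 2 * (128 * x₀ ^ 7) :=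
    mul_le_mul (mul_le_mul_of_nonneg_left hsq hC0) hx₁7le hx₁7.le
      (mul_nonneg hC0 (sq_nonneg _))
  have h3 : C * (2 * π / (5 * x₀ ^ 4)) ^ 2 * (128 * x₀ ^ 7) = 512 * C * π ^ 2 / (25 * x₀) := by
    field_simp
    ring
  have h4 : 10 ≤ 512 * C * π ^ 2 / (25 * x₀) := by linarith [h1, h2, h3.le, h3.ge]
  rw [le_div_iff₀ (by linarith)] at h4
  have hπ2 : π ^ 2 ≤ 16 := by nlinarith [Real.pi_le_four, hπ]
  have h16 : 512 * C * π ^ 2 ≤ 512 * C * 16 := mul_le_mul_of_nonneg_left hπ2 (by linarith)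
  linarith [le_abs_self C]

end Literature.Analysis.PDE

end
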